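import Mathlib.Analysis.SpecialFunctions.Integrability.Basic
import Mathlib.Analysis.Complex.Polynomial.Basic
import Literature.NumberTheory.Transcendental.KZIntervalPeriodProofs
import Literature.NumberTheory.Transcendental.KZPeriodsProofs
import HarnessLib

/-!
# The elliptic integrand of the second kind along a segment between two branch points

Auxiliary results (all proved) for the discharge of the named facts
`Literature.NumberTheory.Transcendental.isPeriod_η₁` / `isPeriod_η₂`
(`Literature/NumberTheory/Transcendental/KontsevichZagier.lean`; Kontsevich–Zagier 2001, §1.1:
elliptic integrals of the second kind are periods). This is the real-algebraic half of the proof,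
complementing the complex-analytic half `KontsevichZagierEllipticLiftProofs.lean`.

Along the segment `γ(s) = p + s d`, `s ∈ [0, 1]`, joining two roots `p`, `q = p + d` of the
Weierstrass cubic, the cubic factors as `4 d³ s (s - 1) (s - κ)` with `κ ∉ [0, 1]` the position of
the third root. We construct an **explicit continuous square root** `y(s)` of it,
`y(s) = 2 i c √s √(1-s) · r(s)` with `c² = d³` and `r(s) = A(s) + iσB(s)` the elementary
continuous square root of `s - κ` (`A = √((m + s - κ₁)/2)`, `B = √((m - s + κ₁)/2)`,
`m = |s - κ|`, `σ = ∓1` the sign making `σ|κ₂| = -κ₂`; real square roots only, so continuity on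
all of `ℝ` is automatic and no branch cut is crossed), and prove
(`exists_sqrt_cubic_segment`):

* `y` is continuous on `ℝ`, `y² = 4d³ s(s-1)(s-κ)` on `[0, 1]`, `y ≠ 0` on `(0, 1)`, `y = 0` off
  `(0, 1)`;
* `d / y` and `(p + s d) d / y` are integrable on `[0, 1]` (inverse-square-root singularities at
  the endpoints: `|y(s)| ≥ 2|c|√δ · √s √(1-s)`);
* **`∫₀¹ (p + s d) d / y(s) ds` is a Kontsevich–Zagier period** when `p, d, κ` are algebraic: the
  real and imaginary parts of the integrand are `ℚ`-semialgebraic functions of `s` (built from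
  `√·`, field operations and real algebraic constants: `KZSemialgebraicComplex.lean`,
  `KZIntervalPeriodProofs.lean`), so `isPeriod_intervalIntegral` applies
  (Kontsevich–Zagier 2001, §1.1: algebraic integrands over `ℚ`-semialgebraic domains).

No new definitions; namespace `Literature.NumberTheory.Transcendental` (path namespace).

## References

* M. Kontsevich, D. Zagier, *Periods* (2001), §1.1.
* J. Bochnak, M. Coste, M.-F. Roy, *Real Algebraic Geometry* (1998), Prop. 2.2.6.
-/

noncomputable section

open Set MeasureTheory intervalIntegral Complex
open Literature.ModelTheory.ExponentialFields (IsSemialgebraic)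

namespace Literature.NumberTheory.Transcendental

/-! ### An elementary continuous square root of `s - κ` along the real line -/

section SqrtBranch

/-- `|t| ≤ √(t² + κ₂²)`. [folklore] -/
theorem abs_le_sqrt_sq_add_sq (t κ₂ : ℝ) : |t| ≤ √(t ^ 2 + κ₂ ^ 2) :=
  Real.abs_le_sqrt (by nlinarith [sq_nonneg κ₂])

/-- **The branch squares to `s - κ`.** For real `κ₁, κ₂, σ` with `σ² = 1` and `σ|κ₂| = -κ₂`, and
`m = √((s-κ₁)² + κ₂²)`, `A = √((m + (s-κ₁))/2)`, `B = √((m - (s-κ₁))/2)`, one has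
`(A + iσB)² = s - (κ₁ + iκ₂)` (`A² - B² = s - κ₁`, `2AB = |κ₂|`; the real and imaginary parts of
the principal square root, up to the sign `σ`). [folklore] -/
theorem sqrtBranch_sq (κ₁ κ₂ σ s : ℝ) (hσ : σ ^ 2 = 1) (hσκ : σ * |κ₂| = -κ₂) :
    (((√((√((s - κ₁) ^ 2 + κ₂ ^ 2) + (s - κ₁)) / 2) : ℝ) : ℂ) +
        I * σ * ((√((√((s - κ₁) ^ 2 + κ₂ ^ 2) - (s - κ₁)) / 2) : ℝ) : ℂ)) ^ 2 =
      (s : ℂ) - (κ₁ + κ₂ * I) := by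
  set t : ℝ := s - κ₁ with ht
  set M : ℝ := √(t ^ 2 + κ₂ ^ 2) with hM
  have hMt : |t| ≤ M := abs_le_sqrt_sq_add_sq t κ₂
  have h1 : 0 ≤ (M + t) / 2 := by linarith [neg_abs_le t]
  have h2 : 0 ≤ (M - t) / 2 := by linarith [le_abs_self t]
  set a : ℝ := √((M + t) / 2) with ha
  set b : ℝ := √((M - t) / 2) with hb
  have ha2 : a ^ 2 = (M + t) / 2 := Real.sq_sqrt h1
  have hb2 : b ^ 2 = (M - t) / 2 := Real.sq_sqrt h2
  have hM2 : M ^ 2 = t ^ 2 + κ₂ ^ 2 := Real.sq_sqrt (by positivity)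
  have hab : a * b = |κ₂| / 2 := by
    rw [ha, hb, ← Real.sqrt_mul h1, show (M + t) / 2 * ((M - t) / 2) = (κ₂ / 2) ^ 2 by
      nlinarith [hM2], Real.sqrt_sq_eq_abs, abs_div, abs_two]
  have hre : a ^ 2 - σ ^ 2 * b ^ 2 = t := by rw [ha2, hb2, hσ]; ring
  have him : 2 * σ * (a * b) = -κ₂ := by rw [hab]; linear_combination hσκ
  have key : ((a : ℂ) + I * σ * b) ^ 2 =
      ((a ^ 2 - σ ^ 2 * b ^ 2 : ℝ) : ℂ) + I * ((2 * σ * (a * b) : ℝ) : ℂ) := by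
    push_cast
    linear_combination ((σ : ℂ) ^ 2 * (b : ℂ) ^ 2) * I_sq
  have hs : (s : ℂ) = (t : ℂ) + κ₁ := by rw [ht]; push_cast; ring
  rw [key, hre, him, hs]
  push_cast
  ring

/-- The branch `s ↦ A(s) + iσB(s)` is continuous on `ℝ` (real square roots of continuous
functions). [folklore] -/
theorem continuous_sqrtBranch (κ₁ κ₂ σ : ℝ) :
    Continuous fun s : ℝ =>
      (((√((√((s - κ₁) ^ 2 + κ₂ ^ 2) + (s - κ₁)) / 2) : ℝ) : ℂ) +
        I * σ * ((√((√((s - κ₁) ^ 2 + κ₂ ^ 2) - (s - κ₁)) / 2) : ℝ) : ℂ)) := by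
  have hM : Continuous fun s : ℝ => √((s - κ₁) ^ 2 + κ₂ ^ 2) :=
    Real.continuous_sqrt.comp (by fun_prop)
  have hA : Continuous fun s : ℝ => √((√((s - κ₁) ^ 2 + κ₂ ^ 2) + (s - κ₁)) / 2) :=
    Real.continuous_sqrt.comp ((hM.add (by fun_prop)).div_const 2)
  have hB : Continuous fun s : ℝ => √((√((s - κ₁) ^ 2 + κ₂ ^ 2) - (s - κ₁)) / 2) :=
    Real.continuous_sqrt.comp ((hM.sub (by fun_prop)).div_const 2)
  exact (continuous_ofReal.comp hA).add
    (continuous_const.mul (continuous_ofReal.comp hB))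

/-- The branch has `ℚ`-semialgebraic real and imaginary parts on any `ℚ`-semialgebraic
`S ⊆ ℝ¹`, when `κ₁, κ₂` are real algebraic and `σ` is rational: they are
`A = √((m + s - κ₁)/2)` and `σB = σ√((m - s + κ₁)/2)`, `m = √((s-κ₁)² + κ₂²)`, built from the
coordinate, algebraic constants, ring operations and `√·`.
[cite: BochnakCosteRoy1998, Prop. 2.2.6] -/
theorem re_im_sqrtBranch {S : Set (Fin 1 → ℝ)} (hS : IsSemialgebraic ℚ S) {κ₁ κ₂ : ℝ}
    (hκ₁ : IsAlgebraic ℚ κ₁) (hκ₂ : IsAlgebraic ℚ κ₂) (σ : ℚ) :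
    IsSemialgebraicFunOn ℚ S (fun x =>
      (((√((√((x 0 - κ₁) ^ 2 + κ₂ ^ 2) + (x 0 - κ₁)) / 2) : ℝ) : ℂ) +
        I * (σ : ℝ) * ((√((√((x 0 - κ₁) ^ 2 + κ₂ ^ 2) - (x 0 - κ₁)) / 2) : ℝ) : ℂ)).re) ∧
    IsSemialgebraicFunOn ℚ S (fun x =>
      (((√((√((x 0 - κ₁) ^ 2 + κ₂ ^ 2) + (x 0 - κ₁)) / 2) : ℝ) : ℂ) +
        I * (σ : ℝ) * ((√((√((x 0 - κ₁) ^ 2 + κ₂ ^ 2) - (x 0 - κ₁)) / 2) : ℝ) : ℂ)).im) := by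
  -- real building blocks
  have ht : IsSemialgebraicFunOn ℚ S (fun x => x 0 - κ₁) :=
    IsSemialgebraicFunOn.sub_holds (isSemialgebraicFunOn_apply hS 0)
      (isSemialgebraicFunOn_const_of_isAlgebraic hS hκ₁)
  have hk : IsSemialgebraicFunOn ℚ S (fun _ => κ₂ ^ 2) :=
    isSemialgebraicFunOn_const_of_isAlgebraic hS (hκ₂.pow 2)
  have hM : IsSemialgebraicFunOn ℚ S (fun x => √((x 0 - κ₁) ^ 2 + κ₂ ^ 2)) := by
    have h := IsSemialgebraicFunOn.add_holds (IsSemialgebraicFunOn.mul_holds ht ht) hk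
    exact IsSemialgebraicFunOn.sqrt_holds (h.congr fun x _ => by simp [sq])
  have hhalf : IsSemialgebraicFunOn ℚ S (fun _ => ((1 / 2 : ℚ) : ℝ)) :=
    isSemialgebraicFunOn_ratCast hS (1 / 2)
  have hA : IsSemialgebraicFunOn ℚ S
      (fun x => √((√((x 0 - κ₁) ^ 2 + κ₂ ^ 2) + (x 0 - κ₁)) / 2)) := by
    have h := IsSemialgebraicFunOn.mul_holds (IsSemialgebraicFunOn.add_holds hM ht) hhalf
    exact IsSemialgebraicFunOn.sqrt_holds (h.congr fun x _ => by simp [div_eq_mul_inv])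
  have hB : IsSemialgebraicFunOn ℚ S
      (fun x => √((√((x 0 - κ₁) ^ 2 + κ₂ ^ 2) - (x 0 - κ₁)) / 2)) := by
    have h := IsSemialgebraicFunOn.mul_holds (IsSemialgebraicFunOn.sub_holds hM ht) hhalf
    exact IsSemialgebraicFunOn.sqrt_holds (h.congr fun x _ => by simp [div_eq_mul_inv])
  have hσB : IsSemialgebraicFunOn ℚ S
      (fun x => (σ : ℝ) * √((√((x 0 - κ₁) ^ 2 + κ₂ ^ 2) - (x 0 - κ₁)) / 2)) :=
    IsSemialgebraicFunOn.mul_holds (isSemialgebraicFunOn_ratCast hS σ) hB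
  refine ⟨hA.congr fun x _ => ?_, hσB.congr fun x _ => ?_⟩
  · simp [Complex.add_re, Complex.mul_re, Complex.ofReal_re, Complex.ofReal_im,
      Complex.I_re, Complex.I_im]
  · simp [Complex.add_im, Complex.mul_im, Complex.mul_re, Complex.ofReal_re, Complex.ofReal_im,
      Complex.I_re, Complex.I_im]

end SqrtBranch

/-! ### Elementary inequalities for the endpoint singularities -/

/-- For `0 < s < 1`: `1 ≤ √s + √(1 - s)` (square both sides). [folklore] -/
theorem one_le_sqrt_add_sqrt_one_sub {s : ℝ} (hs : s ∈ Ioo (0 : ℝ) 1) :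
    1 ≤ √s + √(1 - s) := by
  have h0 : 0 ≤ √s := Real.sqrt_nonneg _
  have h1 : 0 ≤ √(1 - s) := Real.sqrt_nonneg _
  have hs0 : √s ^ 2 = s := Real.sq_sqrt hs.1.le
  have hs1 : √(1 - s) ^ 2 = 1 - s := Real.sq_sqrt (by linarith [hs.2])
  nlinarith [mul_nonneg h0 h1]

/-- For `0 < s < 1`: `(√s √(1-s))⁻¹ ≤ (√s)⁻¹ + (√(1-s))⁻¹`. [folklore] -/
theorem inv_sqrt_mul_sqrt_le {s : ℝ} (hs : s ∈ Ioo (0 : ℝ) 1) :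
    (√s * √(1 - s))⁻¹ ≤ (√s)⁻¹ + (√(1 - s))⁻¹ := by
  have h0 : 0 < √s := Real.sqrt_pos.mpr hs.1
  have h1 : 0 < √(1 - s) := Real.sqrt_pos.mpr (by linarith [hs.2])
  have key := one_le_sqrt_add_sqrt_one_sub hs
  rw [inv_le_iff_one_le_mul₀ (mul_pos h0 h1)]
  calc (1 : ℝ) ≤ √s + √(1 - s) := key
    _ = ((√s)⁻¹ + (√(1 - s))⁻¹) * (√s * √(1 - s)) := by field_simp; ring

/-- The model singularity `s ↦ (√s)⁻¹ + (√(1-s))⁻¹` is integrable on `(0, 1)`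
(`x ^ (-1/2)` is interval integrable: Mathlib `intervalIntegrable_rpow'`). [folklore] -/
theorem integrableOn_inv_sqrt_add_inv_sqrt_one_sub :
    IntegrableOn (fun s : ℝ => (√s)⁻¹ + (√(1 - s))⁻¹) (Ioo 0 1) := by
  have hr : IntervalIntegrable (fun x : ℝ => x ^ (-(1 / 2 : ℝ))) volume 0 1 :=
    intervalIntegral.intervalIntegrable_rpow' (by norm_num)
  have hr' : IntervalIntegrable (fun x : ℝ => (1 - x) ^ (-(1 / 2 : ℝ))) volume 0 1 := by
    simpa using (hr.comp_sub_left 1).symm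
  rw [intervalIntegrable_iff_integrableOn_Ioo_of_le zero_le_one] at hr hr'
  refine (hr.congr_fun ?_ measurableSet_Ioo).add (hr'.congr_fun ?_ measurableSet_Ioo)
  · intro x hx
    simp only
    rw [Real.sqrt_eq_rpow, Real.rpow_neg hx.1.le]
  · intro x hx
    simp only
    rw [Real.sqrt_eq_rpow, Real.rpow_neg (by linarith [hx.2])]

/-! ### The explicit branch of `y` along the segment and the period `∫₀¹ (p + s d) d / y` -/

/-- **The elliptic integrand of the second kind along a segment is a period.** Let
`p, d, κ ∈ ℚ̄` with `d ≠ 0` and `κ ∉ [0, 1]` (as a subset of `ℝ ⊆ ℂ`). Then there is a continuous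
`y : ℝ → ℂ` with `y(s)² = 4d³ s(s-1)(s-κ)` on `[0, 1]` (the factored Weierstrass cubic along
`γ(s) = p + s d` when `p`, `p + d`, `p + κ d` are its roots), `y ≠ 0` exactly on `(0, 1)`, such that
`d / y` and `(p + s d) d / y` are integrable on `[0, 1]` and
`∫₀¹ (p + s d) d / y(s) ds` — the integral `∫ x dx / y` over the segment — **is a Kontsevich–Zagier
period**: its real and imaginary parts are absolutely convergent integrals over the
`ℚ`-semialgebraic interval `(0, 1)` of `ℚ`-semialgebraic functions (Kontsevich–Zagier 2001, §1.1,
"elliptic integrals"; algebraic integrands and coefficients are allowed by the remark after the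
Definition there, in the tree `KZ.isRealPeriod_iff_exists_integralRep_holds`). The branch is
`y(s) = 2ic√s√(1-s)(A(s) + iσB(s))`, `c² = d³`, with `A, B` as in `sqrtBranch_sq`.
[cite: KontsevichZagier2001, §1.1] -/
theorem exists_sqrt_cubic_segment {p d κ : ℂ} (hd : d ≠ 0)
    (hκ : ∀ s ∈ Icc (0 : ℝ) 1, (s : ℂ) ≠ κ)
    (hpa : IsAlgebraic ℚ p) (hda : IsAlgebraic ℚ d) (hκa : IsAlgebraic ℚ κ) :
    ∃ y : ℝ → ℂ, Continuous y ∧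
      (∀ s ∈ Icc (0 : ℝ) 1, y s ^ 2 = 4 * d ^ 3 * s * (s - 1) * (s - κ)) ∧
      (∀ s ∈ Ioo (0 : ℝ) 1, y s ≠ 0) ∧ (∀ s, s ∉ Ioo (0 : ℝ) 1 → y s = 0) ∧
      IntegrableOn (fun s : ℝ => d / y s) (Icc 0 1) ∧
      IntegrableOn (fun s : ℝ => (p + s * d) * d / y s) (Icc 0 1) ∧
      IsPeriod (∫ s in (0 : ℝ)..1, (p + s * d) * d / y s) := by
  /- constants: `c² = d³`, `κ = κ₁ + iκ₂`, the sign `σ` -/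
  obtain ⟨c, hc⟩ : ∃ c : ℂ, c ^ 2 = d ^ 3 := IsAlgClosed.exists_pow_nat_eq (d ^ 3) two_pos
  have hc0 : c ≠ 0 := by
    rintro rfl
    exact pow_ne_zero 3 hd (by simpa using hc.symm)
  have hca : IsAlgebraic ℚ c := isAlgebraic_of_sq_eq (hda.pow 3) hc
  set κ₁ : ℝ := κ.re with hκ₁
  set κ₂ : ℝ := κ.im with hκ₂
  have hκeq : (κ₁ : ℂ) + κ₂ * I = κ := Complex.re_add_im κ
  set σ : ℚ := if κ₂ ≤ 0 then 1 else -1 with hσdef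
  have hσ : ((σ : ℝ)) ^ 2 = 1 := by
    rw [hσdef]; split_ifs <;> norm_num
  have hσκ : (σ : ℝ) * |κ₂| = -κ₂ := by
    rw [hσdef]
    split_ifs with h
    · rw [abs_of_nonpos h]; simp
    · rw [abs_of_pos (lt_of_not_ge h)]; simp
  /- the branch `r` of `√(s - κ)` and the function `y` -/
  set r : ℝ → ℂ := fun s =>
    ((√((√((s - κ₁) ^ 2 + κ₂ ^ 2) + (s - κ₁)) / 2) : ℝ) : ℂ) +
      I * (σ : ℝ) * ((√((√((s - κ₁) ^ 2 + κ₂ ^ 2) - (s - κ₁)) / 2) : ℝ) : ℂ) with hr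
  have hr2 : ∀ s : ℝ, r s ^ 2 = (s : ℂ) - κ := fun s => by
    rw [← hκeq]
    exact sqrtBranch_sq κ₁ κ₂ σ s hσ hσκ
  have hrc : Continuous r := continuous_sqrtBranch κ₁ κ₂ σ
  set y : ℝ → ℂ := fun s => 2 * I * c * (√s : ℝ) * (√(1 - s) : ℝ) * r s with hy
  have hsqrt_c : Continuous fun s : ℝ => ((√s : ℝ) : ℂ) :=
    continuous_ofReal.comp Real.continuous_sqrt
  have hsqrt1_c : Continuous fun s : ℝ => ((√(1 - s) : ℝ) : ℂ) :=
    continuous_ofReal.comp (Real.continuous_sqrt.comp (continuous_const.sub continuous_id))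
  have hyc : Continuous y := ((continuous_const.mul hsqrt_c).mul hsqrt1_c).mul hrc
  /- `y² = 4d³ s(s-1)(s-κ)` on `[0, 1]` -/
  have hsq : ∀ s ∈ Icc (0 : ℝ) 1, y s ^ 2 = 4 * d ^ 3 * s * (s - 1) * (s - κ) := by
    intro s hs
    have hs2 : ((√s : ℝ) : ℂ) ^ 2 = s := by
      rw [← ofReal_pow, Real.sq_sqrt hs.1]
    have h1s2 : ((√(1 - s) : ℝ) : ℂ) ^ 2 = 1 - (s : ℂ) := by
      rw [← ofReal_pow, Real.sq_sqrt (by linarith [hs.2])]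
      push_cast
      ring
    have e : y s ^ 2 = (2 * I * c) ^ 2 * ((√s : ℝ) : ℂ) ^ 2 * ((√(1 - s) : ℝ) : ℂ) ^ 2 *
        r s ^ 2 := by
      simp only [hy]
      ring
    rw [e, hr2 s, hs2, h1s2]
    linear_combination (4 * (s : ℂ) * ((s : ℂ) - κ) * (1 - (s : ℂ)) * c ^ 2) * I_sq -
      (4 * (s : ℂ) * ((s : ℂ) - κ) * (1 - (s : ℂ))) * hc
  /- `y ≠ 0` on `(0, 1)` -/
  have hy0 : ∀ s ∈ Ioo (0 : ℝ) 1, y s ≠ 0 := by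
    intro s hs
    have h1 : (2 * I * c : ℂ) ≠ 0 := mul_ne_zero (mul_ne_zero two_ne_zero I_ne_zero) hc0
    have h2 : ((√s : ℝ) : ℂ) ≠ 0 := ofReal_ne_zero.mpr (Real.sqrt_ne_zero'.mpr hs.1)
    have h3 : ((√(1 - s) : ℝ) : ℂ) ≠ 0 :=
      ofReal_ne_zero.mpr (Real.sqrt_ne_zero'.mpr (by linarith [hs.2]))
    have h4 : r s ≠ 0 := by
      intro h0
      have := hr2 s
      rw [h0, zero_pow two_ne_zero] at this
      exact hκ s (Ioo_subset_Icc_self hs) (sub_eq_zero.mp this.symm)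
    simp only [hy]
    exact mul_ne_zero (mul_ne_zero (mul_ne_zero h1 h2) h3) h4
  /- `y = 0` off `(0, 1)` -/
  have hyoff : ∀ s, s ∉ Ioo (0 : ℝ) 1 → y s = 0 := by
    intro s hs
    simp only [mem_Ioo, not_and_or, not_lt] at hs
    rcases hs with hs | hs
    · have : √s = 0 := Real.sqrt_eq_zero'.mpr hs
      simp [hy, this]
    · have : √(1 - s) = 0 := Real.sqrt_eq_zero'.mpr (by linarith)
      simp [hy, this]
  /- the lower bound `‖y s‖ ≥ 2‖c‖√δ √s √(1-s)` on `(0, 1)` -/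
  obtain ⟨δ, hδ, hδle⟩ : ∃ δ > 0, ∀ s ∈ Icc (0 : ℝ) 1, δ ≤ ‖(s : ℂ) - κ‖ := by
    have hcont : Continuous fun s : ℝ => ‖(s : ℂ) - κ‖ := by fun_prop
    obtain ⟨s₀, hs₀, hmin⟩ :=
      isCompact_Icc.exists_isMinOn (nonempty_Icc.mpr zero_le_one) hcont.continuousOn
    exact ⟨‖(s₀ : ℂ) - κ‖, norm_pos_iff.mpr (sub_ne_zero.mpr (hκ s₀ hs₀)),
      fun s hs => hmin hs⟩
  have hrnorm : ∀ s ∈ Icc (0 : ℝ) 1, √δ ≤ ‖r s‖ := by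
    intro s hs
    have h : δ ≤ ‖r s‖ ^ 2 := by
      rw [← norm_pow, hr2 s]
      exact hδle s hs
    calc √δ ≤ √(‖r s‖ ^ 2) := Real.sqrt_le_sqrt h
      _ = ‖r s‖ := Real.sqrt_sq (norm_nonneg _)
  set K : ℝ := ‖d‖ / (2 * ‖c‖ * √δ) with hK
  have hK0 : 0 ≤ K := by positivity
  have hbound : ∀ s ∈ Ioo (0 : ℝ) 1, ‖d / y s‖ ≤ K * ((√s)⁻¹ + (√(1 - s))⁻¹) := by
    intro s hs
    have h0 : 0 < √s := Real.sqrt_pos.mpr hs.1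
    have h1 : 0 < √(1 - s) := Real.sqrt_pos.mpr (by linarith [hs.2])
    have hδ' : 0 < √δ := Real.sqrt_pos.mpr hδ
    have hc' : 0 < ‖c‖ := norm_pos_iff.mpr hc0
    have hnorm : ‖y s‖ = 2 * ‖c‖ * √s * √(1 - s) * ‖r s‖ := by
      simp only [hy, norm_mul, Complex.norm_ofNat, Complex.norm_I, Complex.norm_real,
        Real.norm_eq_abs, abs_of_pos h0, abs_of_pos h1]
      ring
    have hlow : 2 * ‖c‖ * √δ * (√s * √(1 - s)) ≤ ‖y s‖ := by
      rw [hnorm]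
      have := hrnorm s (Ioo_subset_Icc_self hs)
      calc 2 * ‖c‖ * √δ * (√s * √(1 - s)) = 2 * ‖c‖ * √s * √(1 - s) * √δ := by ring
        _ ≤ 2 * ‖c‖ * √s * √(1 - s) * ‖r s‖ := by gcongr
    have hpos : 0 < 2 * ‖c‖ * √δ * (√s * √(1 - s)) := by positivity
    calc ‖d / y s‖ = ‖d‖ / ‖y s‖ := norm_div _ _
      _ ≤ ‖d‖ / (2 * ‖c‖ * √δ * (√s * √(1 - s))) :=
        div_le_div_of_nonneg_left (norm_nonneg d) hpos hlow
      _ = K * (√s * √(1 - s))⁻¹ := by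
        rw [hK, ← div_eq_mul_inv, div_div]
      _ ≤ K * ((√s)⁻¹ + (√(1 - s))⁻¹) := by
        gcongr
        exact inv_sqrt_mul_sqrt_le hs
  /- integrability on `(0, 1)` and `[0, 1]` -/
  have hmodel := integrableOn_inv_sqrt_add_inv_sqrt_one_sub
  have hcont₁ : ContinuousOn (fun s : ℝ => d / y s) (Ioo 0 1) :=
    continuousOn_const.div hyc.continuousOn fun s hs => hy0 s hs
  have hcont₂ : ContinuousOn (fun s : ℝ => (p + s * d) * d / y s) (Ioo 0 1) :=
    (Continuous.continuousOn (by fun_prop)).div hyc.continuousOn fun s hs => hy0 s hs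
  have hint₁ : IntegrableOn (fun s : ℝ => d / y s) (Ioo 0 1) := by
    refine Integrable.mono' (hmodel.const_mul K) (hcont₁.aestronglyMeasurable measurableSet_Ioo)
      ((ae_restrict_mem measurableSet_Ioo).mono fun s hs => ?_)
    exact hbound s hs
  have hint₂ : IntegrableOn (fun s : ℝ => (p + s * d) * d / y s) (Ioo 0 1) := by
    refine Integrable.mono' (hmodel.const_mul ((‖p‖ + ‖d‖) * K))
      (hcont₂.aestronglyMeasurable measurableSet_Ioo)
      ((ae_restrict_mem measurableSet_Ioo).mono fun s hs => ?_)
    have hps : ‖p + s * d‖ ≤ ‖p‖ + ‖d‖ := by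
      refine (norm_add_le _ _).trans ?_
      gcongr
      rw [norm_mul, Complex.norm_real, Real.norm_eq_abs, abs_of_pos hs.1]
      have : (s : ℝ) * ‖d‖ ≤ 1 * ‖d‖ := by gcongr; exact hs.2.le
      linarith
    have hmodel0 : 0 ≤ (√s)⁻¹ + (√(1 - s))⁻¹ := by positivity
    calc ‖(p + s * d) * d / y s‖ = ‖p + s * d‖ * ‖d / y s‖ := by
          rw [mul_div_assoc, norm_mul]
      _ ≤ (‖p‖ + ‖d‖) * (K * ((√s)⁻¹ + (√(1 - s))⁻¹)) := by
          gcongr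
          exact hbound s hs
      _ = (‖p‖ + ‖d‖) * K * ((√s)⁻¹ + (√(1 - s))⁻¹) := by ring
  have hint₁' : IntegrableOn (fun s : ℝ => d / y s) (Icc 0 1) :=
    (integrableOn_Icc_iff_integrableOn_Ioo).mpr hint₁
  have hint₂' : IntegrableOn (fun s : ℝ => (p + s * d) * d / y s) (Icc 0 1) :=
    (integrableOn_Icc_iff_integrableOn_Ioo).mpr hint₂
  /- semialgebraicity of the real and imaginary parts of the integrand on `(0, 1)` -/
  have hD := isSemialgebraic_unitInterval_fin_one
  have hp' := isAlgebraic_re_im hpa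
  have hd' := isAlgebraic_re_im hda
  have hκ' := isAlgebraic_re_im hκa
  have hI : IsAlgebraic ℚ I :=
    isAlgebraic_of_sq_eq (z := -1) (by simpa using isAlgebraic_int (R := ℚ) (A := ℂ) (-1)) I_sq
  have h2 : IsAlgebraic ℚ (2 : ℂ) := by simpa using isAlgebraic_int (R := ℚ) (A := ℂ) 2
  have h2Ic := isAlgebraic_re_im ((h2.mul hI).mul hca)
  have hN := re_im_mul (re_im_add (re_im_const hD hp'.1 hp'.2)
    (re_im_mul (re_im_coord hD) (re_im_const hD hd'.1 hd'.2))) (re_im_const hD hd'.1 hd'.2)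
  have hsqrtS : IsSemialgebraicFunOn ℚ {x : Fin 1 → ℝ | 0 < x 0 ∧ x 0 < 1} (fun x => √(x 0)) :=
    IsSemialgebraicFunOn.sqrt_holds (isSemialgebraicFunOn_apply hD 0)
  have hsqrt1S : IsSemialgebraicFunOn ℚ {x : Fin 1 → ℝ | 0 < x 0 ∧ x 0 < 1}
      (fun x => √(1 - x 0)) := by
    have h := IsSemialgebraicFunOn.sub_holds (isSemialgebraicFunOn_ratCast hD 1)
      (isSemialgebraicFunOn_apply hD 0)
    exact IsSemialgebraicFunOn.sqrt_holds (h.congr fun x _ => by simp)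
  have hrS := re_im_sqrtBranch hD hκ'.1 hκ'.2 σ
  have hY := re_im_mul (re_im_mul (re_im_mul (re_im_const hD h2Ic.1 h2Ic.2)
    (re_im_ofReal hD hsqrtS)) (re_im_ofReal hD hsqrt1S)) hrS
  have hY0 : ∀ x ∈ {x : Fin 1 → ℝ | 0 < x 0 ∧ x 0 < 1}, y (x 0) ≠ 0 := fun x hx => hy0 (x 0) hx
  have hdivS := re_im_div hN (F := fun x => (p + ((x 0 : ℝ) : ℂ) * d) * d)
    (G := fun x => y (x 0)) ⟨hY.1.congr fun x _ => rfl, hY.2.congr fun x _ => rfl⟩ hY0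
  have hper : IsPeriod (∫ s in (0 : ℝ)..1, (p + s * d) * d / y s) :=
    isPeriod_intervalIntegral (h := fun s : ℝ => (p + s * d) * d / y s)
      (hdivS.1.congr fun x _ => rfl) (hdivS.2.congr fun x _ => rfl) hint₂
  exact ⟨y, hyc, hsq, hy0, hyoff, hint₁', hint₂', hper⟩

end Literature.NumberTheory.Transcendental
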